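import Literature.NumberTheory.NumberFields.CubicFieldOneRealPlace
import Literature.Algebra.Polynomial.RealCubicRoots
import Mathlib.NumberTheory.NumberField.InfinitePlace.TotallyRealComplex
import HarnessLib

/-!
# A cubic field of POSITIVE discriminant is TOTALLY REAL (signature `(3, 0)`); the signature of a cubic field from the sign of the discriminant

Topic `NumberTheory/NumberFields`; namespace `Literature.NumberTheory.NumberFields`. Theorem-only file (no definition, no named fact, no
`sorry`), written by the prover seat `bsd-line-att-p4` g33 (cell `bsd-f1-sign2`, `--supports` stmt-BirchSwinnertonDyer-22298; closes nothing there).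
Companion of `CubicFieldOneRealPlace.lean` (k4-w1: `disc < 0 ⟹` exactly one real place), which left «the converse (`disc > 0` ⟹ totally real)» as
not done. The signature `(r₁, r₂)` of `K = ℚ(θ)` is read off the minimal polynomial `T` of `θ`: `r₁` is the number of real roots of `T` (Cohen,
Def. 4.1.9, §4.1.3) and `sign d(K) = (−1)^{r₂}` (Cohen, Prop. 4.8.11). For a CUBIC: `disc T > 0` iff three real roots iff `K` totally real.

* `conj_eq_of_mem_roots_of_discr_pos` — a real cubic (`a ≠ 0`) with `disc > 0` has only REAL complex roots (the tree's `roots_real_or_conj_pair` /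
  `discr_neg_of_conj_pair`, `Literature/Algebra/Polynomial/RealCubicRoots`).
* `conj_apply_eq_of_aeval_cubic_eq_zero_of_discr_pos` — every complex embedding of a number field sends a root `θ` of a rational cubic with `disc > 0`
  to a real number; **`isReal_of_cubic_discr_pos`** — hence every complex embedding of a field with a power basis generated by such a `θ` is real;
  **`isTotallyReal_of_cubic_discr_pos`** — the field is totally real; `nrComplexPlaces_eq_zero_of_cubic_discr_pos`, `nrRealPlaces_eq_finrank_…`.
* `not_isTotallyReal_of_cubic_discr_neg` (from k4-w1's `nrRealPlaces_eq_one_of_cubic_discr_neg`, `[K:ℚ] = 3`) and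
  **`isTotallyReal_iff_cubic_discr_pos`** — for `[K : ℚ] = 3` and `disc ≠ 0`: `K` totally real ⟺ `disc > 0`.
* `isTotallyReal_adjoin_of_cubic_discr_pos` — the currency `ℚ(θ) ⊂ ℚ̄`.

## References

* H. Cohen, *A Course in Computational Algebraic Number Theory*, GTM 138 (1993), §4.1.3 (Def. 4.1.9, Algorithm 4.1.11) and Prop. 4.8.11. [Cohen1993]
* D. S. Dummit, R. M. Foote, *Abstract Algebra*, §14.6 (a real cubic has three real roots iff its discriminant is positive). [DummitFoote2004]
-/

noncomputable section

open Polynomial NumberField Complex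
open scoped ComplexConjugate

namespace Literature.NumberTheory.NumberFields

/-! ### Real cubics with positive discriminant have only real roots -/

/-- The discriminant of a cubic commutes with ring maps: `disc(φ P) = φ(disc P)` (private helper, as in `CubicFieldOneRealPlace`). [folklore] -/
private theorem cubic_discr_map' {R S : Type*} [CommRing R] [CommRing S] (φ : R →+* S) (P : Cubic R) :
    (Cubic.map φ P).discr = φ P.discr := by
  simp only [Cubic.discr, Cubic.map, map_add, map_sub, map_mul, map_pow, map_ofNat]

/-- **A real cubic (`a ≠ 0`) with POSITIVE discriminant has only real complex roots**: every root `u ∈ ℂ` of `P ⊗ ℂ` satisfies `conj u = u`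
(the three roots are distinct since `disc ≠ 0`; were two of them a conjugate pair, `disc < 0`).
[cite: Cohen1993, §4.1.3 (Def. 4.1.9)] [cite: DummitFoote2004, §14.6] -/
theorem conj_eq_of_mem_roots_of_discr_pos {P : Cubic ℝ} (ha : P.a ≠ 0) (hd : 0 < P.discr) {u : ℂ}
    (hu : u ∈ (Cubic.map ofRealHom P).roots) : conj u = u := by
  classical
  have hsplit : (P.toPoly.map ofRealHom).Splits := IsAlgClosed.splits _
  obtain ⟨x, y, z, h3⟩ := (Cubic.splits_iff_roots_eq_three ha).mp hsplit
  obtain ⟨hxy, hxz, hyz⟩ := (Cubic.discr_ne_zero_iff_roots_ne ha h3).mp hd.ne'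
  rcases Literature.Algebra.Polynomial.roots_real_or_conj_pair ha h3 hxy hxz hyz with ⟨hx, hy, hz⟩ | ⟨t, v, ht, hv, h3'⟩
  · rw [h3] at hu
    simp only [Multiset.insert_eq_cons, Multiset.mem_cons, Multiset.mem_singleton] at hu
    rcases hu with rfl | rfl | rfl
    exacts [hx, hy, hz]
  · exact absurd hd (not_lt.mpr (Literature.Algebra.Polynomial.discr_neg_of_conj_pair ha h3' ht hv).le)

/-! ### Number fields generated by a root of a rational cubic with positive discriminant -/

section NumberField

variable {K : Type*} [Field K] [NumberField K]

/-- A complex embedding of a number field sends a root `θ` of a rational cubic `P` to a complex root of `P`. [folklore] -/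
private theorem mem_roots_embedding_of_aeval_cubic_eq_zero {P : Cubic ℚ} (ha : P.a ≠ 0) {θ : K} (hθ : aeval θ P.toPoly = 0)
    (φ : K →+* ℂ) : φ θ ∈ (Cubic.map ofRealHom (Cubic.map (algebraMap ℚ ℝ) P)).roots := by
  have hmap : Cubic.map ofRealHom (Cubic.map (algebraMap ℚ ℝ) P) = Cubic.map (algebraMap ℚ ℂ) P := by
    simp only [Cubic.map, Complex.ofRealHom_eq_coe, eq_ratCast, Complex.ofReal_ratCast]
  have ha' : (Cubic.map (algebraMap ℚ ℂ) P).a ≠ 0 := by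
    rw [Cubic.map]; exact (map_ne_zero (algebraMap ℚ ℂ)).mpr ha
  rw [hmap, Cubic.roots, Polynomial.mem_roots (Cubic.ne_zero_of_a_ne_zero ha'), Cubic.map_toPoly, Polynomial.IsRoot,
    Polynomial.eval_map, ← Polynomial.aeval_def]
  have h : φ.toRatAlgHom (aeval θ P.toPoly) = 0 := by rw [hθ, map_zero]
  rw [← Polynomial.aeval_algHom_apply] at h
  exact h

/-- **Every complex embedding sends a root of a rational cubic with `disc > 0` to a REAL number.** [cite: Cohen1993, §4.1.3 (Def. 4.1.9)] -/
theorem conj_apply_eq_of_aeval_cubic_eq_zero_of_discr_pos {P : Cubic ℚ} (ha : P.a ≠ 0) (hd : 0 < P.discr) {θ : K}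
    (hθ : aeval θ P.toPoly = 0) (φ : K →+* ℂ) : conj (φ θ) = φ θ := by
  have ha' : (Cubic.map (algebraMap ℚ ℝ) P).a ≠ 0 := by
    rw [Cubic.map]; exact (map_ne_zero (algebraMap ℚ ℝ)).mpr ha
  have hd' : 0 < (Cubic.map (algebraMap ℚ ℝ) P).discr := by
    rw [cubic_discr_map', eq_ratCast]; exact_mod_cast hd
  exact conj_eq_of_mem_roots_of_discr_pos ha' hd' (mem_roots_embedding_of_aeval_cubic_eq_zero ha hθ φ)

/-- **Every complex embedding is real** for a number field with a power basis over `ℚ` whose generator is a root of a rational cubic of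
POSITIVE discriminant: `conj ∘ φ` and `φ` agree on the generator. [cite: Cohen1993, §4.1.3 (Def. 4.1.9: `r₁` = number of real roots of the minimal polynomial)] -/
theorem isReal_of_cubic_discr_pos (pb : PowerBasis ℚ K) {P : Cubic ℚ} (ha : P.a ≠ 0) (hd : 0 < P.discr)
    (hgen : aeval pb.gen P.toPoly = 0) (φ : K →+* ℂ) : ComplexEmbedding.IsReal φ := by
  rw [ComplexEmbedding.isReal_iff]
  have hgen' : ComplexEmbedding.conjugate φ pb.gen = φ pb.gen := by
    rw [ComplexEmbedding.conjugate_coe_eq]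
    exact conj_apply_eq_of_aeval_cubic_eq_zero_of_discr_pos ha hd hgen φ
  have halg : (ComplexEmbedding.conjugate φ).toRatAlgHom = φ.toRatAlgHom :=
    pb.algHom_ext (by rw [RingHom.toRatAlgHom_apply, RingHom.toRatAlgHom_apply]; exact hgen')
  exact RingHom.ext fun x => by simpa only [RingHom.toRatAlgHom_apply] using DFunLike.congr_fun halg x

/-- **TOTALLY REAL.** A number field with a power basis over `ℚ` whose generator is a root of a rational cubic (`a ≠ 0`) of POSITIVE
discriminant is totally real (signature `(3, 0)` when `[K : ℚ] = 3`). [cite: Cohen1993, §4.1.3 (Def. 4.1.9) and Prop. 4.8.11 (`sign d(K) = (−1)^{r₂}`)]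
[cite: DummitFoote2004, §14.6] -/
theorem isTotallyReal_of_cubic_discr_pos (pb : PowerBasis ℚ K) {P : Cubic ℚ} (ha : P.a ≠ 0) (hd : 0 < P.discr)
    (hgen : aeval pb.gen P.toPoly = 0) : IsTotallyReal K := by
  refine ⟨fun w ↦ ?_⟩
  rw [InfinitePlace.isReal_iff]
  exact isReal_of_cubic_discr_pos pb ha hd hgen w.embedding

/-- `disc > 0` ⟹ no complex place. [cite: Cohen1993, Prop. 4.8.11] -/
theorem nrComplexPlaces_eq_zero_of_cubic_discr_pos (pb : PowerBasis ℚ K) {P : Cubic ℚ} (ha : P.a ≠ 0) (hd : 0 < P.discr)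
    (hgen : aeval pb.gen P.toPoly = 0) : InfinitePlace.nrComplexPlaces K = 0 := by
  haveI := isTotallyReal_of_cubic_discr_pos pb ha hd hgen
  exact NumberField.nrComplexPlaces_eq_zero_iff.mpr inferInstance

/-- `disc > 0` ⟹ all `[K : ℚ]` places are real. [cite: Cohen1993, Prop. 4.8.11] -/
theorem nrRealPlaces_eq_finrank_of_cubic_discr_pos (pb : PowerBasis ℚ K) {P : Cubic ℚ} (ha : P.a ≠ 0) (hd : 0 < P.discr)
    (hgen : aeval pb.gen P.toPoly = 0) : InfinitePlace.nrRealPlaces K = Module.finrank ℚ K := by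
  have h := InfinitePlace.card_add_two_mul_card_eq_rank K
  rw [nrComplexPlaces_eq_zero_of_cubic_discr_pos pb ha hd hgen] at h
  omega

/-- **`disc < 0` ⟹ NOT totally real** for `[K : ℚ] = 3` (exactly one real place, k4-w1's `nrRealPlaces_eq_one_of_cubic_discr_neg`).
[cite: Cohen1993, Prop. 4.8.11 and §4.1.3] -/
theorem not_isTotallyReal_of_cubic_discr_neg (pb : PowerBasis ℚ K) (h3 : Module.finrank ℚ K = 3) {P : Cubic ℚ} (ha : P.a ≠ 0)
    (hd : P.discr < 0) (hgen : aeval pb.gen P.toPoly = 0) : ¬ IsTotallyReal K := by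
  intro hK
  have h1 := nrRealPlaces_eq_one_of_cubic_discr_neg pb h3 ha hd hgen
  have h0 : InfinitePlace.nrComplexPlaces K = 0 := NumberField.nrComplexPlaces_eq_zero_iff.mpr hK
  have h := InfinitePlace.card_add_two_mul_card_eq_rank K
  omega

/-- ★ **THE SIGNATURE OF A CUBIC FIELD FROM THE SIGN OF THE DISCRIMINANT**: for `[K : ℚ] = 3` with a power basis whose generator is a root of a
rational cubic `P` (`a ≠ 0`, `disc P ≠ 0`): **`K` is totally real ⟺ `disc P > 0`** (and otherwise `K` has exactly one real place).
[cite: Cohen1993, §4.1.3 (Def. 4.1.9, Algorithm 4.1.11) and Prop. 4.8.11] [cite: DummitFoote2004, §14.6] -/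
theorem isTotallyReal_iff_cubic_discr_pos (pb : PowerBasis ℚ K) (h3 : Module.finrank ℚ K = 3) {P : Cubic ℚ} (ha : P.a ≠ 0)
    (hd0 : P.discr ≠ 0) (hgen : aeval pb.gen P.toPoly = 0) : IsTotallyReal K ↔ 0 < P.discr := by
  constructor
  · intro hK
    rcases hd0.lt_or_gt with hlt | hgt
    · exact absurd hK (not_isTotallyReal_of_cubic_discr_neg pb h3 ha hlt hgen)
    · exact hgt
  · exact fun hd ↦ isTotallyReal_of_cubic_discr_pos pb ha hd hgen

end NumberField

/-! ### The currency `ℚ(θ) ⊂ ℚ̄` -/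

/-- **`ℚ(θ) ⊂ ℚ̄` is totally real** when `θ` is a root of a rational cubic (`a ≠ 0`) with POSITIVE discriminant (no degree hypothesis: if the cubic is
reducible, `ℚ(θ)` is `ℚ` or a real quadratic field). [cite: Cohen1993, §4.1.3 and Prop. 4.8.11] -/
theorem isTotallyReal_adjoin_of_cubic_discr_pos {θ : AlgebraicClosure ℚ} {P : Cubic ℚ} (ha : P.a ≠ 0) (hd : 0 < P.discr)
    (hθ : aeval θ P.toPoly = 0) :
    haveI : FiniteDimensional ℚ (IntermediateField.adjoin ℚ {θ}) :=
      IntermediateField.adjoin.finiteDimensional ((AlgebraicClosure.isAlgebraic ℚ).isAlgebraic θ).isIntegral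
    haveI : NumberField (IntermediateField.adjoin ℚ {θ}) := NumberField.mk
    IsTotallyReal (IntermediateField.adjoin ℚ {θ}) := by
  have hθint : IsIntegral ℚ θ := ((AlgebraicClosure.isAlgebraic ℚ).isAlgebraic θ).isIntegral
  haveI : FiniteDimensional ℚ (IntermediateField.adjoin ℚ {θ}) := IntermediateField.adjoin.finiteDimensional hθint
  haveI : NumberField (IntermediateField.adjoin ℚ {θ}) := NumberField.mk
  have hgen : aeval (IntermediateField.adjoin.powerBasis hθint).gen P.toPoly = 0 := by
    rw [IntermediateField.adjoin.powerBasis_gen]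
    apply (algebraMap (IntermediateField.adjoin ℚ {θ}) (AlgebraicClosure ℚ)).injective
    rw [← Polynomial.aeval_algebraMap_apply, IntermediateField.AdjoinSimple.algebraMap_gen, map_zero, hθ]
  exact isTotallyReal_of_cubic_discr_pos (IntermediateField.adjoin.powerBasis hθint) ha hd hgen

/-- **`ℚ(θ) ⊂ ℚ̄` is NOT totally real** when `θ` is a root of a rational cubic (`a ≠ 0`) with NEGATIVE discriminant and `[ℚ(θ) : ℚ] = 3`.
[cite: Cohen1993, §4.1.3 and Prop. 4.8.11] -/
theorem not_isTotallyReal_adjoin_of_cubic_discr_neg {θ : AlgebraicClosure ℚ} {P : Cubic ℚ} (ha : P.a ≠ 0) (hd : P.discr < 0)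
    (hθ : aeval θ P.toPoly = 0) (h3 : Module.finrank ℚ (IntermediateField.adjoin ℚ {θ}) = 3) :
    haveI : FiniteDimensional ℚ (IntermediateField.adjoin ℚ {θ}) :=
      IntermediateField.adjoin.finiteDimensional ((AlgebraicClosure.isAlgebraic ℚ).isAlgebraic θ).isIntegral
    haveI : NumberField (IntermediateField.adjoin ℚ {θ}) := NumberField.mk
    ¬ IsTotallyReal (IntermediateField.adjoin ℚ {θ}) := by
  have hθint : IsIntegral ℚ θ := ((AlgebraicClosure.isAlgebraic ℚ).isAlgebraic θ).isIntegral
  haveI : FiniteDimensional ℚ (IntermediateField.adjoin ℚ {θ}) := IntermediateField.adjoin.finiteDimensional hθint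
  haveI : NumberField (IntermediateField.adjoin ℚ {θ}) := NumberField.mk
  have hgen : aeval (IntermediateField.adjoin.powerBasis hθint).gen P.toPoly = 0 := by
    rw [IntermediateField.adjoin.powerBasis_gen]
    apply (algebraMap (IntermediateField.adjoin ℚ {θ}) (AlgebraicClosure ℚ)).injective
    rw [← Polynomial.aeval_algebraMap_apply, IntermediateField.AdjoinSimple.algebraMap_gen, map_zero, hθ]
  exact not_isTotallyReal_of_cubic_discr_neg (IntermediateField.adjoin.powerBasis hθint) h3 ha hd hgen

end Literature.NumberTheory.NumberFields

end
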